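import Mathlib
import Summits.CriticalPhenomena.CardyFormulaZ2.Theorems.CardySelfRefinementDefs
import Summits.CriticalPhenomena.CardyFormulaZ2.Theorems.CardySelfRefinementRussoDriftModel
import Summits.CriticalPhenomena.CardyFormulaZ2.Theorems.CardySelfRefinementGradientComparabilityStubPathPointLower
import Summits.CriticalPhenomena.CardyFormulaZ2.Theorems.CardySelfRefinementGradientComparabilityStubPathPointUpperDuality
import Literature.Probability.Percolation.SelfRefinementMeasure
import HarnessLib

/-!
# (N-hi) Uniform upper non-degeneracy of the joint crossing probability along an RSW path

Crux `stmt-CriticalPhenomena-10269`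
(`Summit.CriticalPhenomena.CardyFormulaZ2.Theses.CardySelfRefinement.GradientComparability`),
line **Sketch**, stub `stub_pathPoint_upper` (input (N-hi) of the proved composition
`kestenDictionary`).  Vocabulary (`M`, `A`, `P`, `PathOK`, `nnSupport`, …) from
`CardySelfRefinementDefs` / `CardySelfRefinementRussoDriftModel`; the deterministic tube machinery
(`stub_jointCrossing_tube`, `chain`, `dist_le_of_mem_boxes`) from the (D1) helper file
`…StubJointCrossingNondegenerateTube`; the long-way GOOD continua of boxes without short-way open
crossings (`continua_of_not_mem`: lattice shadows + continuum duality) from the helper file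
`…StubPathPointUpperDuality`; FKG for `M_k` (`isPositivelyAssociated_M`) from the sibling
`…StubPathPointLower`; the crossing criterion `mem_configOf_iff_exists_isCrossing` from
`…StubBoundaryValuesHi`.

## Mathematics

Fix `k`, an admissible path `γ`, a nonempty quad family `F` and let `Qt` be the transpose of
`F 0` (`Quad.exists_transpose`: same carrier, sides `0, 2` of `Qt` are sides `1, 3` of `F 0`).
The tube lemma for `Qt` gives mesh-independent points `P₀, …, P_N` at consecutive distances `≤ s`:
a continuum inside a set `GOOD`, glued (`chain`) from long-way crossings of the `2(N+1)` boxes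
`10s × 2s` / `2s × 10s` around the `P_j`, contains a crossing of `Qt` inside `GOOD`.  Here
`GOOD` is the complement of the drawn lattice (open edges and all vertices, mesh `δ = η√2`), so a
crossing of `Qt` inside `GOOD` is a continuum in `[F 0]` from `∂₁F 0` to `∂₃F 0` off the open
edges; it meets every open crossing of `F 0` (`Quad.exists_mem_of_isPreconnected_crossing'`,
crossings inside open edges being path crossings, `joinedIn_inter_openEdgeUnion_of_isConnected`),
which is absurd.  Hence on the event that all `2(N+1)` boxes carry such GOOD long-way paths, `F 0`
— a fortiori the family — is NOT crossed.

A GOOD long-way path in a box exists as soon as the explicit `n × n/8` (resp. `n/8 × n`) lattice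
rectangle of the drawing `v ↦ √2 v - w` at the integer scale `n = ⌊8s/η⌋₊` inside it has no open
SHORT-way crossing (`continua_of_not_mem`), i.e. off the events `embTBCrossing (z - w) n (n/8)` /
`embRectCrossing (z - w') (n/8) n` of the box-crossing bounds at aspect ratio `1/8`.  By the UPPER
half of `PathOK`'s two-sided bounds each has `M_k(γ s)`-probability `≤ 1 - c₀` for `n ≥ n₀`,
uniformly in the path parameter; their complements are decreasing, so by Harris–FKG for
decreasing events (`IsPositivelyAssociated.prod_real_le_iInter_lowerSet`,
`isPositivelyAssociated_M`) all `2(N+1)` complements hold simultaneously with probability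
`≥ (c₀²)^{N+1}`.  Therefore `P = M_k(A ∩ nnSupport) ≤ 1 - (c₀²)^{N+1} =: v₂ < 1` for
`0 < η < min (s/6) (s/(n₀+1))`.
-/

noncomputable section

namespace Summit.CriticalPhenomena.CardyFormulaZ2.Theorems.CardySelfRefinement

open scoped Topology
open Filter Set MeasureTheory Metric
open Literature.Probability.LatticeModels Literature.Probability.Percolation
open Literature.Probability.Percolation.QuadCrossing
open Summit.CriticalPhenomena.CardyFormulaZ2.Theses.CardySelfRefinement

/-! ## The blocking event at a tube point has probability `≥ c₀²` -/

/-- FKG for two decreasing events, `μ.real` form (`IsPositivelyAssociated.lowerSet`). -/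
theorem real_mul_le_inter_of_isLowerSet {Ω : Type*} [MeasurableSpace Ω] [Preorder Ω]
    {μ : Measure Ω} [IsProbabilityMeasure μ] (h : IsPositivelyAssociated μ) {A B : Set Ω}
    (hA : IsLowerSet A) (hB : IsLowerSet B) (hAm : MeasurableSet A) (hBm : MeasurableSet B) :
    μ.real A * μ.real B ≤ μ.real (A ∩ B) := by
  have h' := h.lowerSet hA hB hAm hBm
  rw [measureReal_def, measureReal_def, measureReal_def, ← ENNReal.toReal_mul]
  exact ENNReal.toReal_mono (measure_ne_top μ _) h'

/-- **The blocking event has probability `≥ c₀²`.**  Under a positively associated probability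
measure with box-crossing bounds `(c₀, n₀)` at aspect ratio `1/8`, for `n ≥ n₀` and any two
translations `u, u'`, with probability `≥ c₀²` NEITHER the open top–bottom (short-way) crossing of
the `n × n/8` rectangle at `u` NOR the open left–right (short-way) crossing of the `n/8 × n`
rectangle at `u'` occurs (UPPER bounds for the two short-way crossings, FKG for their decreasing
complements). -/
theorem le_real_block {μ : Measure (BondConfig (Site 2))} [IsProbabilityMeasure μ]
    (hμ : IsPositivelyAssociated μ) {c₀ : ℝ} {n₀ : ℕ} (hc₀ : 0 ≤ c₀)
    (hB : BoxCrossingBounds μ squareLatticeEmbedding.z (1 / 8) c₀ n₀) {n : ℕ} (hn : n₀ ≤ n)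
    (u u' : ℂ) :
    c₀ * c₀ ≤ μ.real
      ((embTBCrossing (fun v => squareLatticeEmbedding.z v - u) n ((1 / 8 : ℝ) * n))ᶜ ∩
        (embRectCrossing (fun v => squareLatticeEmbedding.z v - u') ((1 / 8 : ℝ) * n) n)ᶜ) := by
  have h1 := (hB n hn u).2.2
  have h2 := (hB n hn u').1.2
  refine le_trans ?_ (real_mul_le_inter_of_isLowerSet hμ (isUpperSet_embTBCrossing _ _ _).compl
    (isUpperSet_embRectCrossing _ _ _).compl
    (IsoradialArmExtension.measurableSet_embTBCrossing _ _ _).compl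
    (IsoradialArmExtension.measurableSet_embRectCrossing _ _ _).compl)
  rw [probReal_compl_eq_one_sub (IsoradialArmExtension.measurableSet_embTBCrossing _ _ _),
    probReal_compl_eq_one_sub (IsoradialArmExtension.measurableSet_embRectCrossing _ _ _)]
  exact mul_le_mul (by linarith) (by linarith) hc₀ (by linarith)

/-! ## The stub -/

/-- **(N-hi) UNIFORM UPPER NON-DEGENERACY ALONG THE PATH.**  For an RSW path `γ` and a nonempty
finite quad family `F`, the joint crossing probability `P_η(γ s)` is bounded above by a constant
`v₂ < 1` for all path parameters `s` and all small meshes: with probability `≥ (c₀²)^{N+1}`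
(upper box-crossing bounds of `PathOK` at aspect ratio `1/8`, Harris–FKG for decreasing events
under `M_k`) none of the `2(N+1)` boxes of the tube of the transposed first quad has an open
short-way crossing; then (continuum duality and lattice shadows `continua_of_not_mem`, `chain`,
`stub_jointCrossing_tube`) a continuum off the drawn lattice joins `∂₁F 0` to `∂₃F 0` inside
`[F 0]` and blocks every open crossing of `F 0`; `P = M_k(A ∩ nnSupport)`
(`P_eq_inter_nnSupport`). -/
theorem stub_pathPoint_upper :
    ∀ k : ℕ, k = 2 ∨ k = 3 → ∀ γ : unitInterval → ℝ × ℝ, PathOK k γ →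
      ∀ (m : ℕ) (F : Fin m → Quad (Set.univ : Set ℂ)), 0 < m →
        ∃ v₂ η₆ : ℝ, v₂ < 1 ∧ 0 < η₆ ∧ ∀ η ∈ Set.Ioo 0 η₆, ∀ s : unitInterval,
          P k m F η (γ s).1 (γ s).2 ≤ v₂ := by
  intro k _hk γ hγ m F hm
  obtain ⟨c₀, hc₀, n₀, hbox⟩ := hγ.2.2.2.2.2.2 (1 / 8) (by norm_num)
  obtain ⟨Qt, hcar, ht0, -, ht2, -⟩ := (F ⟨0, hm⟩).exists_transpose
  obtain ⟨N, Pt, sz, hsz, hPdist, htube⟩ := stub_jointCrossing_tube Qt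
  refine ⟨1 - (c₀ * c₀) ^ (N + 1), min (sz / 6) (sz / (n₀ + 1)),
    by linarith [pow_pos (mul_pos hc₀ hc₀) (N + 1)], by positivity, fun η hη s => ?_⟩
  have hη0 : 0 < η := hη.1
  obtain ⟨hη6, hηn⟩ := lt_min_iff.1 hη.2
  rw [lt_div_iff₀ (by norm_num : (0:ℝ) < 6)] at hη6
  rw [lt_div_iff₀ (by positivity : (0:ℝ) < n₀ + 1)] at hηn
  have hηs : 6 * η ≤ sz := by linarith
  have hδ : 0 < η * Real.sqrt 2 := by positivity
  -- the integer scale `n = ⌊8 sz / η⌋₊`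
  set n : ℕ := ⌊8 * sz / η⌋₊ with hndef
  have hfl := Nat.lt_floor_add_one (8 * sz / η)
  have hfl' := Nat.floor_le (show 0 ≤ 8 * sz / η by positivity)
  rw [div_lt_iff₀ hη0] at hfl
  rw [le_div_iff₀ hη0] at hfl'
  have hn1 : 8 * sz - η < η * n := by rw [hndef]; linarith
  have hn2 : η * n ≤ 8 * sz := by rw [hndef]; linarith
  have hn0 : n₀ ≤ n := by
    by_contra hcon
    have h' : (n : ℝ) < n₀ := by exact_mod_cast Nat.lt_of_not_le hcon
    have := mul_lt_mul_of_pos_left h' hη0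
    linarith
  haveI : IsProbabilityMeasure (M k (γ s).1 (γ s).2) := isProbabilityMeasure_M k _ _
  -- the blocking events: no short-way open crossing of the two boxes at `P_j`
  set uH : ℕ → ℂ := fun j => ⟨((Pt j).re - 4 * sz) / η, ((Pt j).im - sz) / η⟩ with huH
  set uV : ℕ → ℂ := fun j => ⟨((Pt j).re - sz) / η, ((Pt j).im - 4 * sz) / η⟩ with huV
  set E : Fin (N + 1) → Set (BondConfig (Site 2)) := fun j =>
    (embTBCrossing (fun v => squareLatticeEmbedding.z v - uH j) n ((1 / 8 : ℝ) * n))ᶜ ∩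
      (embRectCrossing (fun v => squareLatticeEmbedding.z v - uV j) ((1 / 8 : ℝ) * n) n)ᶜ with hE
  have hEm : ∀ j, MeasurableSet (E j) := fun j =>
    (IsoradialArmExtension.measurableSet_embTBCrossing _ _ _).compl.inter
      (IsoradialArmExtension.measurableSet_embRectCrossing _ _ _).compl
  have hEl : ∀ j, IsLowerSet (E j) := fun j =>
    (isUpperSet_embTBCrossing _ _ _).compl.inter (isUpperSet_embRectCrossing _ _ _).compl
  -- they hold simultaneously with probability `≥ (c₀²)^(N+1)`
  have hEp : (c₀ * c₀) ^ (N + 1) ≤ (M k (γ s).1 (γ s).2).real (⋂ j, E j) := by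
    calc (c₀ * c₀) ^ (N + 1) = ∏ _j : Fin (N + 1), c₀ * c₀ := (Fin.prod_const _ _).symm
      _ ≤ ∏ j, (M k (γ s).1 (γ s).2).real (E j) :=
          Finset.prod_le_prod (fun _ _ => by positivity) fun j _ =>
            le_real_block (isPositivelyAssociated_M k _ _) hc₀.le (hbox s) hn0 (uH j) (uV j)
      _ ≤ _ := (isPositivelyAssociated_M k _ _).prod_real_le_iInter_lowerSet hEl hEm
  -- on the blocking events (and the support) `F 0` is not crossed
  have hdisj : A m F η ∩ nnSupport ⊆ (⋂ j, E j)ᶜ := by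
    rintro ω ⟨hωA, hωN⟩ hωE
    rw [mem_iInter] at hωE
    have HH := fun (j : ℕ) (hj : j ≤ N) => (continua_of_not_mem hη0 hηs hn1 hn2 (Pt j)
      (hωE ⟨j, Nat.lt_succ_of_le hj⟩).1 (hωE ⟨j, Nat.lt_succ_of_le hj⟩).2).1
    have HV := fun (j : ℕ) (hj : j ≤ N) => (continua_of_not_mem hη0 hηs hn1 hn2 (Pt j)
      (hωE ⟨j, Nat.lt_succ_of_le hj⟩).1 (hωE ⟨j, Nat.lt_succ_of_le hj⟩).2).2
    choose! Hc hHc using HH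
    choose! Vc hVc using HV
    obtain ⟨C, hCc, hCp, hCG, hCd, hC0, hCN⟩ := chain Pt _ Hc Vc N hPdist hHc hVc
    obtain ⟨z0, hz0, -⟩ := (hVc 0 (Nat.zero_le _)).2.2.2.2.1
    obtain ⟨zN, hzN, -⟩ := (hHc N le_rfl).2.2.2.2.1
    obtain ⟨K, ⟨hKc, hKconn, hKQ, hK1, hK3⟩, hKG⟩ := htube _ C hCc hCp hCG hCd
      ⟨z0, hC0 hz0, dist_le_of_mem_boxes (Or.inr ((hVc 0 (Nat.zero_le _)).2.2.2.1 hz0))⟩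
      ⟨zN, hCN hzN, dist_le_of_mem_boxes (Or.inl ((hHc N le_rfl).2.2.2.1 hzN))⟩
    -- an open crossing of `F 0` is a path crossing, which meets `K`
    obtain ⟨K₀, ⟨hK₀c, hK₀conn, hK₀Q, ⟨a, haK, ha⟩, ⟨b, hbK, hb⟩⟩, hK₀O⟩ :=
      (mem_configOf_iff_exists_isCrossing hη0 hωN (F ⟨0, hm⟩)).1 (hωA ⟨0, hm⟩)
    obtain ⟨π, hπ⟩ := joinedIn_inter_openEdgeUnion_of_isConnected hδ hK₀c hK₀conn hK₀O hK₀Q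
      haK hbK
    have hπ' : ∀ u, π.extend u ∈ (F ⟨0, hm⟩).carrier ∩ openEdgeUnion (η * Real.sqrt 2) ω :=
      fun u => by
        obtain ⟨v, hv⟩ : π.extend u ∈ range π := by rw [← π.extend_range]; exact mem_range_self u
        rw [← hv]; exact hπ v
    obtain ⟨u, -, hu⟩ := (F ⟨0, hm⟩).exists_mem_of_isPreconnected_crossing' hKc
      hKconn.isPreconnected (hcar ▸ hKQ) (ht0 ▸ hK1) (ht2 ▸ hK3) (β := fun u => π.extend u)
      π.continuous_extend.continuousOn (fun u _ => (hπ' u).1) (by simpa using ha)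
      (by simpa using hb)
    exact hKG hu (Or.inl (hπ' u).2)
  rw [P_eq_inter_nnSupport]
  calc (M k (γ s).1 (γ s).2).real (A m F η ∩ nnSupport)
      ≤ (M k (γ s).1 (γ s).2).real (⋂ j, E j)ᶜ := measureReal_mono hdisj
    _ = 1 - (M k (γ s).1 (γ s).2).real (⋂ j, E j) :=
        probReal_compl_eq_one_sub (MeasurableSet.iInter hEm)
    _ ≤ 1 - (c₀ * c₀) ^ (N + 1) := by linarith

end Summit.CriticalPhenomena.CardyFormulaZ2.Theorems.CardySelfRefinement

end
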